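import Summits.MatrixMultiplication.MatrixMultiplication.Theses.DefinableSTPPDichotomy
import Summits.MatrixMultiplication.MatrixMultiplication.Theorems.PairwiseCurvedTilingsLC.Negative.UniformEta
import Summits.MatrixMultiplication.MatrixMultiplication.Theorems.PairwiseCurvedTilingsLC.Negative.PairwiseCurvedTilingsLCShadowCounting

/-!
# `PairwiseCurvedTilingsLC` (crux stmt-MatrixMultiplication-17883): THIN BLOCKS ARE DEAD — the
strengthening "every block has a colour class of bounded size" is false

Negative-side lemmas (refuter / cdisprove seat, cycle 1), elementary and sorry-free; the pairwise
STPP clause is inlined verbatim as in `UniformEta.lean`, whose three packings are reused.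

* `sum_card_mul_le_of_thin` — if every block of a pairwise-STPP family in a finite abelian group
  `H` has a colour class of size `≤ K` (`|A_x| ≤ K ∨ |B_x| ≤ K ∨ |C_x| ≤ K`), then
  `Σ_x |A_x||B_x||C_x| ≤ 3K·|H|` (per block `abc ≤ K(ab + bc + ca)`, then the three packings);
* `not_PairwiseCurvedTilingsLC_thinBlocks` — hence the crux with the extra conjunct
  `∀ x ∈ I, |A_x| ≤ K ∨ |B_x| ≤ K ∨ |C_x| ≤ K` is FALSE for every `K` (take `ε = 1`: the mass is
  `Σ abc ≤ 3K|F|^m < |F|^{m+η}` once `|F|^η > 3K`).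

Consequence for the item: every witness of `PairwiseCurvedTilingsLC` has, far enough along its field
sequence, FAT blocks — all three classes of size `> K`, for every `K` — carrying all but `3K|F|^m` of
the mass; for definable families these are the blocks with three positive-dimensional classes
(Chatzidakis–van den Dries–Macintyre), exactly the regime of the translate-recurrence hypothesis of
the companion negative lemma `PairwiseCurvedTilingsLC_false_of_DefinableTranslateRecurrenceLC`.
Thin blocks die by counting (this file); fat blocks die by recurrence (that file).

References: H. Cohn, R. Kleinberg, B. Szegedy, C. Umans, FOCS 2005, Def. 5.1 (the clause);
J. Blasiak, T. Church, H. Cohn, J. A. Grochow, E. Naslund, W. F. Sawin, C. Umans, Discrete Analysis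
2017:3, §2 (packings).
-/

set_option linter.dupNamespace false  -- `Summit.<S>.<S>.…` is the mandated namespace

namespace Summit.MatrixMultiplication.MatrixMultiplication.Theorems.PairwiseCurvedTilingsLC.Negative

open Finset

/-! ## Thin blocks carry at most `3K·|H|` of the mass -/

section Thin

variable {H : Type*} [AddCommGroup H] [Fintype H] {ι : Type*} {I : Finset ι} {A B C : ι → Finset H}
  (hP : ∀ i ∈ I, ∀ j ∈ I, ∀ k ∈ I, (i = j ∨ j = k ∨ k = i) →
    ∀ s ∈ A k, ∀ s' ∈ A i, ∀ t ∈ B i, ∀ t' ∈ B j, ∀ u ∈ C j, ∀ u' ∈ C k,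
      (s' - s) + (t' - t) + (u' - u) = 0 → i = j ∧ j = k ∧ s = s' ∧ t = t' ∧ u = u')
include hP

/-- **Thin blocks carry little mass.**  If every block of a pairwise-STPP family has a colour class
of size `≤ K`, then `Σ_x |A_x||B_x||C_x| ≤ 3K·|H|` (per block `abc ≤ K(ab + bc + ca)`, then the
three packings of `UniformEta.lean`). -/
theorem sum_card_mul_le_of_thin (K : ℕ)
    (hthin : ∀ x ∈ I, (A x).card ≤ K ∨ (B x).card ≤ K ∨ (C x).card ≤ K) :
    ∑ x ∈ I, (A x).card * (B x).card * (C x).card ≤ 3 * K * Fintype.card H := by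
  set I' := I.filter (fun x => (A x).Nonempty ∧ (B x).Nonempty ∧ (C x).Nonempty) with hI'
  have hAB := sum_card_AB_le hP (H := H)
  have hBC := sum_card_BC_le hP (H := H)
  have hAC := sum_card_AC_le hP (H := H)
  rw [← hI'] at hAB hBC hAC
  -- only the blocks of `I'` contribute
  have hsplit : ∑ x ∈ I, (A x).card * (B x).card * (C x).card =
      ∑ x ∈ I', (A x).card * (B x).card * (C x).card := by
    rw [hI', sum_filter_of_ne]
    intro x _ hx
    by_contra hcon
    apply hx
    simp only [not_and_or, not_nonempty_iff_eq_empty] at hcon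
    rcases hcon with h' | h' | h' <;> simp [h']
  rw [hsplit]
  have hper : ∀ x ∈ I', (A x).card * (B x).card * (C x).card ≤
      K * ((A x).card * (B x).card + (B x).card * (C x).card + (A x).card * (C x).card) := by
    intro x hx
    have hxI : x ∈ I := (mem_filter.1 (hI' ▸ hx)).1
    rcases hthin x hxI with h | h | h
    · calc (A x).card * (B x).card * (C x).card = (A x).card * ((B x).card * (C x).card) := by ring
        _ ≤ K * ((B x).card * (C x).card) := Nat.mul_le_mul_right _ h
        _ ≤ _ := by nlinarith [Nat.zero_le ((A x).card * (B x).card), Nat.zero_le ((A x).card * (C x).card)]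
    · calc (A x).card * (B x).card * (C x).card = (B x).card * ((A x).card * (C x).card) := by ring
        _ ≤ K * ((A x).card * (C x).card) := Nat.mul_le_mul_right _ h
        _ ≤ _ := by nlinarith [Nat.zero_le ((A x).card * (B x).card), Nat.zero_le ((B x).card * (C x).card)]
    · calc (A x).card * (B x).card * (C x).card = (C x).card * ((A x).card * (B x).card) := by ring
        _ ≤ K * ((A x).card * (B x).card) := Nat.mul_le_mul_right _ h
        _ ≤ _ := by nlinarith [Nat.zero_le ((B x).card * (C x).card), Nat.zero_le ((A x).card * (C x).card)]
  calc ∑ x ∈ I', (A x).card * (B x).card * (C x).card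
      ≤ ∑ x ∈ I', K * ((A x).card * (B x).card + (B x).card * (C x).card + (A x).card * (C x).card) :=
        sum_le_sum hper
    _ = K * (∑ x ∈ I', (A x).card * (B x).card + ∑ x ∈ I', (B x).card * (C x).card +
          ∑ x ∈ I', (A x).card * (C x).card) := by
        rw [← mul_sum, sum_add_distrib, sum_add_distrib]
    _ ≤ K * (Fintype.card H + Fintype.card H + Fintype.card H) := by gcongr
    _ = 3 * K * Fintype.card H := by ring

end Thin

/-- **The thin-block strengthening of the crux is FALSE** (unconditional, every `K`): there is no
witness of `PairwiseCurvedTilingsLC` all of whose blocks have a colour class of size `≤ K`.  At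
`ε = 1` the mass is `Σ abc ≤ 3K·|F|^m` (`sum_card_mul_le_of_thin`), `< |F|^{m+η}` once `|F|^η > 3K`.
So every witness has, far along its field sequence, FAT blocks (`|A_x|, |B_x|, |C_x| > K`) carrying
all but `3K|F|^m` of the mass — for definable families, blocks with three positive-dimensional
classes (CDM), which is where `DefinableTranslateRecurrenceLC` bites. -/
theorem not_PairwiseCurvedTilingsLC_thinBlocks (K : ℕ) :
    ¬ ∃ (e m k : ℕ) (φI : FirstOrder.Language.ring.Formula (Fin e ⊕ Fin k))
        (φA φB φC : FirstOrder.Language.ring.Formula ((Fin e ⊕ Fin m) ⊕ Fin k)),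
        ∀ ε : ℝ, 0 < ε → ∃ η : ℝ, 0 < η ∧ ∀ q₀ : ℕ, ∃ (F : Type) (_ : Field F) (_ : Fintype F)
          (_ : FirstOrder.Ring.CompatibleRing F), q₀ ≤ ringChar F ∧ ∃ (y : Fin k → F)
          (I : Finset (Fin e → F)) (A B C : (Fin e → F) → Finset (Fin m → F)),
          (∀ x, x ∈ I ↔ φI.Realize (Sum.elim x y)) ∧
          (∀ x v, v ∈ A x ↔ φA.Realize (Sum.elim (Sum.elim x v) y)) ∧
          (∀ x v, v ∈ B x ↔ φB.Realize (Sum.elim (Sum.elim x v) y)) ∧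
          (∀ x v, v ∈ C x ↔ φC.Realize (Sum.elim (Sum.elim x v) y)) ∧
          (∀ i ∈ I, ∀ j ∈ I, ∀ k ∈ I, (i = j ∨ j = k ∨ k = i) → ∀ s ∈ A k, ∀ s' ∈ A i,
            ∀ t ∈ B i, ∀ t' ∈ B j, ∀ u ∈ C j, ∀ u' ∈ C k,
            (s' - s) + (t' - t) + (u' - u) = 0 → i = j ∧ j = k ∧ s = s' ∧ t = t' ∧ u = u') ∧
          (Fintype.card F : ℝ) ^ ((m : ℝ) + η) ≤
            ∑ x ∈ I, (((A x).card * (B x).card * (C x).card : ℕ) : ℝ) ^ ((2 + ε) / 3) ∧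
          (∀ x ∈ I, (A x).card ≤ K ∨ (B x).card ≤ K ∨ (C x).card ≤ K) := by
  rintro ⟨e, m, k, φI, φA, φB, φC, h⟩
  obtain ⟨η, hη, hall⟩ := h 1 one_pos
  set N : ℕ := Nat.ceil (((3 * K : ℕ) + 1 : ℝ) ^ (1 / η)) with hN
  obtain ⟨F, instF, instFin, instCR, hchar, y, I, A, B, C, -, -, -, -, hP, hmass, hthin⟩ :=
    hall (max N 2)
  have hcardF : max N 2 ≤ Fintype.card F := hchar.trans (ringChar_le_card F)
  set q : ℝ := (Fintype.card F : ℝ) with hqdef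
  have hq2 : (2 : ℝ) ≤ q := by
    rw [hqdef]; exact_mod_cast le_trans (le_max_right _ _) hcardF
  have hq0 : (0 : ℝ) < q := by linarith
  have hKq : ((3 * K : ℕ) : ℝ) < q ^ η := by
    have h1 : (((3 * K : ℕ) : ℝ) + 1) ^ (1 / η) ≤ q := by
      have : (N : ℝ) ≤ q := by
        rw [hqdef]; exact_mod_cast le_trans (le_max_left _ _) hcardF
      exact le_trans (Nat.le_ceil _) this
    have h2 : ((3 * K : ℕ) : ℝ) + 1 ≤ q ^ η := by
      calc ((3 * K : ℕ) : ℝ) + 1 = ((((3 * K : ℕ) : ℝ) + 1) ^ (1 / η)) ^ η := by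
            rw [← Real.rpow_mul (by positivity), one_div, inv_mul_cancel₀ hη.ne', Real.rpow_one]
        _ ≤ q ^ η := Real.rpow_le_rpow (by positivity) h1 hη.le
    linarith
  -- at `ε = 1` the mass is `Σ abc`
  have hexp : ((2 : ℝ) + 1) / 3 = 1 := by norm_num
  rw [hexp] at hmass
  simp only [Real.rpow_one] at hmass
  have hthinle := sum_card_mul_le_of_thin (H := Fin m → F) hP K hthin
  have hcardH : (Fintype.card (Fin m → F) : ℝ) = q ^ (m : ℝ) := by
    rw [Real.rpow_natCast, Fintype.card_fun, Fintype.card_fin]; push_cast; rfl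
  have hmass' : q ^ ((m : ℝ) + η) ≤ ((3 * K : ℕ) : ℝ) * q ^ (m : ℝ) := by
    calc q ^ ((m : ℝ) + η) ≤ ∑ x ∈ I, (((A x).card * (B x).card * (C x).card : ℕ) : ℝ) := hmass
      _ = ((∑ x ∈ I, (A x).card * (B x).card * (C x).card : ℕ) : ℝ) := by push_cast; rfl
      _ ≤ ((3 * K * Fintype.card (Fin m → F) : ℕ) : ℝ) := by exact_mod_cast hthinle
      _ = ((3 * K : ℕ) : ℝ) * q ^ (m : ℝ) := by rw [← hcardH]; push_cast; ring
  have hlt : ((3 * K : ℕ) : ℝ) * q ^ (m : ℝ) < q ^ ((m : ℝ) + η) := by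
    rw [Real.rpow_add hq0, mul_comm]
    exact mul_lt_mul_of_pos_left hKq (Real.rpow_pos_of_pos hq0 _)
  exact absurd hmass' (not_le.2 hlt)

end Summit.MatrixMultiplication.MatrixMultiplication.Theorems.PairwiseCurvedTilingsLC.Negative
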